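import Mathlib.Algebra.Order.BigOperators.Group.Finset
import Mathlib.Algebra.BigOperators.Group.Finset.Basic
import Mathlib.Data.Finset.Sum
import Mathlib.Data.Nat.Size
import Literature.Computability.Complexity.PaulPippengerSzemerediTrotter1983Segregators
import Literature.Computability.Complexity.PaulPippengerSzemerediTrotter1983LogStar
import HarnessLib

/-!
# The segregator theorem for multi-pushdown graphs (Paul–Pippenger–Szemerédi–Trotter 1983, Theorem 2.1) — proved

Literature / complexity toolkit, brick of the inline formalization of Paul–Pippenger–Szemerédi–
Trotter 1983 (`PaulPippengerSzemerediTrotter1983.lean`, fact `PaulEtAl1983_NTIME_not_subset_DTIME`).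
The combinatorial heart of the paper, §2 "A Segregator Theorem", PROVED here over the vocabulary
of `…Segregators.lean` (`IsPushdownFamily`, `IsMultiPushdownGraph r N E` = the printed `H_{r+1}(N)`
with the successor edges kept apart, `ancestorsAvoiding`, `IsSegregator`) and the iterated
logarithm `logStar` of `…LogStar.lean`, following the printed proof step by step (primary source
now read: the authors' copy of the FOCS paper, pp. 430–432):

* `PPSTSeg.cseq`, `PPSTSeg.cseq_bound`, `PPSTSeg.params`, `PPSTSeg.aseq`, `PPSTSeg.aseq_level` —
  **Lemma 2.2**: for `log* n ≥ 8` an integer `k = 2^κ ≥ log* n / 8` and block sizes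
  `1 = d₀ | d₁ | ⋯ | d_k ≤ 2^n` (powers of two, `d_l = 2^{a_l}`) with condition (4) in the form
  `d_l · k^{2^n/d_{l+1} + 1} ≤ 2 · 2^n` ("straightforward estimates": the tower bound
  `c_m + κ + 1 ≤ tower (κ + m + 1)` and `tower (log* n) ≤ n`, `PPSTSeg.tower_le_of_le_logStar`);
* `PPSTSeg.card_le_of_nonCrossing` — the claim `Σ_X D_s(X*) ≤ 2N*`: a set of pairwise
  non-crossing forward arcs on `M` nodes has at most `2M` arcs (a node that immediately precedes
  `Y < Z` is the FIRST immediate predecessor of `Y`);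
* `PPSTSeg.Core` and `namespace PPSTSeg.Core` — the proof of **Theorem 2.1** on `2^n` vertices:
  the level of an edge (coarsest separating partition among `P₀,…,P_{k-1}`, `Core.lev`), the
  pigeonhole over levels (`Core.exists_level`) and the set `A` (`Core.A`, `|A| k ≤ |E| ≤ R 2^n`),
  the collapsed graphs `G*_s`, `G*` (`Core.Arc`, `Core.Arcs`; arcs go forward and join different
  blocks of `P_{l+1}`, `Core.nd_props`; arcs of one family do not cross, `Core.nonCrossing_Arc`;
  `|Arcs| ≤ 2 R N*`), in-degrees and the bad nodes `B*` (`|B*| (k+1) ≤ 2RN*`), the set `B` of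
  vertices in bad blocks (`|B| (k+1) ≤ 2R 2^n`), `J = A ∪ B` with `|J| k ≤ 3R 2^n` (`Core.card_J`),
  and the predecessor count: paths of `G − J` project to paths of `G* − B*` (`Core.step_blocks`),
  whose nodes have in-degree `≤ k` and whose arcs advance the block of `P_{l+1}`, so a vertex of
  `G − J` has at most `d_l · k^{M*} ≤ 2 · 2^n / k` ancestors (`Core.ncard_ancestors_le`,
  `Core.isSegregator_J`);
* **`segregator_theorem`** — Theorem 2.1 for every `N` and `r` in the shape used downstream
  (`…Assembly`): `∀ r, ∃ C, ∀ N E, IsMultiPushdownGraph r N E → ∃ J, |J| · log* N ≤ C N ∧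
  IsSegregator (C N / log* N) J E N` (pad `N` to `2^{size N}`, small `log*` handled by the trivial
  segregator `{0,…,N-1}`; `C = 48 (r+1) + 32`).

Deviations from the printed text, all inessential: block sizes and `k` are powers of two and `N`
is padded to a power of two (so every "⌈N/d⌉" is exact), the `k` of the pigeonhole and the degree
threshold coincide as printed, constants are not optimized (`15 r` ↦ `48 (r+1)`, `6` ↦ `32`), and
`log*` is the tree's floor-iterated binary logarithm. No named fact is introduced (definitions with
bodies and theorems only).

## References

* W. J. Paul, N. Pippenger, E. Szemerédi, W. T. Trotter, *On determinism versus non-determinism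
  and related problems*, 24th FOCS (1983) 429–438, doi:10.1109/sfcs.1983.39, §2 "A Segregator
  Theorem": Theorem 2.1 and Lemma 2.2 (p. 431), proof of Theorem 2.1 (pp. 431–432)
  [PaulEtAl1983].
* R. Santhanam, *On separators, segregators and time versus space*, CCC 2001, §2 (p. 4: "[24]
  shows that the class H_r(n) of multi-pushdown graphs has (n/log* n, n/log* n) segregators")
  [Santhanam2001].
* P. Erdős, R. L. Graham, E. Szemerédi, *On sparse graphs with dense long paths*, Comp. & Math.
  with Appl. 1 (1975) 365–369 (the depth-reduction technique, cited loc. cit.).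
-/

namespace Literature.Computability.Complexity

open Finset Relation

namespace PPSTSeg

/-! ### Arithmetic: towers, `log*`, and the block-size sequence of Lemma 2.2 -/

/-- `k < tower k`. [folklore] -/
theorem lt_tower : ∀ k, k < tower k
  | 0 => Nat.one_pos
  | k + 1 => by
    have ih := lt_tower k
    have : tower k < 2 ^ tower k := Nat.lt_two_pow_self
    show k + 1 < 2 ^ tower k
    omega

/-- `tower` is monotone. [folklore] -/
theorem tower_mono : Monotone tower := by
  refine monotone_nat_of_le_succ fun k => ?_
  show tower k ≤ 2 ^ tower k
  exact Nat.lt_two_pow_self.le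

/-- **`log* n ≥ j ≥ 1` forces `n ≥ tower j`** (the jumps of `log*` are exactly at the towers).
[folklore] -/
theorem tower_le_of_le_logStar : ∀ (j n : ℕ), 1 ≤ j → j ≤ logStar n → tower j ≤ n := by
  intro j
  induction j with
  | zero => intro n h; omega
  | succ j ih =>
    intro n _ hjn
    rcases Nat.lt_or_ge n 2 with hn | hn
    · rw [logStar_of_le_one (by omega)] at hjn; omega
    · rw [logStar_of_two_le hn] at hjn
      rcases Nat.eq_zero_or_pos j with hj0 | hj0
      · subst hj0; show 2 ^ 1 ≤ n; omega
      · have h1 := ih (Nat.log 2 n) hj0 (by omega)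
        show 2 ^ tower j ≤ n
        calc 2 ^ tower j ≤ 2 ^ Nat.log 2 n := Nat.pow_le_pow_right two_pos h1
          _ ≤ n := Nat.pow_log_le_self 2 (by omega)

/-- **The sequence `c₀ = 0`, `c_{m+1} = κ (2^{c_m} + 1)`** (logarithms of the numbers of blocks of
the partitions of Lemma 2.2, read from the coarsest level down; `κ = log₂ k`).
[cite: PaulEtAl1983, §2 Lemma 2.2 (the numbers e_{k,l})] -/
def cseq (κ : ℕ) : ℕ → ℕ
  | 0 => 0
  | m + 1 => κ * (2 ^ cseq κ m + 1)

/-- `c₀ = 0`. [folklore] -/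
@[simp] theorem cseq_zero (κ : ℕ) : cseq κ 0 = 0 := rfl

/-- `c_{m+1} = κ (2^{c_m} + 1)`. [folklore] -/
theorem cseq_succ (κ m : ℕ) : cseq κ (m + 1) = κ * (2 ^ cseq κ m + 1) := rfl

/-- `cseq κ` is monotone (for `κ ≥ 1`). [folklore] -/
theorem cseq_mono {κ : ℕ} (hκ : 1 ≤ κ) : Monotone (cseq κ) := by
  refine monotone_nat_of_le_succ fun m => ?_
  rw [cseq_succ]
  have : cseq κ m < 2 ^ cseq κ m := Nat.lt_two_pow_self
  nlinarith

/-- `3κ + 1 ≤ 2^{κ+1}` for `κ ≥ 1`. [folklore] -/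
theorem three_mul_succ_le_two_pow {κ : ℕ} (hκ : 1 ≤ κ) : 3 * κ + 1 ≤ 2 ^ (κ + 1) := by
  induction κ with
  | zero => omega
  | succ κ ih =>
    rcases Nat.eq_zero_or_pos κ with h0 | h0
    · subst h0; norm_num
    · have := ih h0
      rw [pow_succ]
      omega

/-- **"Straightforward estimates"**: `c_m + κ + 1 ≤ tower (κ + m + 1)`.
[cite: PaulEtAl1983, §2 Lemma 2.2 (e_{k,l} ≤ exp^{(k+2l)} 1)] -/
theorem cseq_bound {κ : ℕ} (hκ : 1 ≤ κ) : ∀ m, cseq κ m + κ + 1 ≤ tower (κ + m + 1)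
  | 0 => by
    show 0 + κ + 1 ≤ 2 ^ tower (κ + 0)
    have h1 := lt_tower (κ + 0)
    have h2 : tower (κ + 0) < 2 ^ tower (κ + 0) := Nat.lt_two_pow_self
    omega
  | m + 1 => by
    have ih := cseq_bound hκ m
    show κ * (2 ^ cseq κ m + 1) + κ + 1 ≤ 2 ^ tower (κ + m + 1)
    have h3 := three_mul_succ_le_two_pow hκ
    -- `κ (2^c + 1) + κ + 1 ≤ (3κ + 1) 2^c ≤ 2^{κ+1} 2^c = 2^{c+κ+1} ≤ 2^{tower …}`
    have hc : 1 ≤ 2 ^ cseq κ m := Nat.one_le_two_pow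
    calc κ * (2 ^ cseq κ m + 1) + κ + 1
        ≤ (3 * κ + 1) * 2 ^ cseq κ m := by nlinarith
      _ ≤ 2 ^ (κ + 1) * 2 ^ cseq κ m := Nat.mul_le_mul_right _ h3
      _ = 2 ^ (cseq κ m + κ + 1) := by rw [← pow_add]; ring_nf
      _ ≤ 2 ^ tower (κ + m + 1) := Nat.pow_le_pow_right two_pos ih

/-- **Lemma 2.2 (parameters).** For `log* n ≥ 8` there is `κ ≥ 1` with `log* n < 8 · 2^κ` and
`c_{2^κ} ≤ n`: with `k = 2^κ` levels the whole block-size sequence fits below `2^n` vertices, and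
`k ≥ log* n / 8`. [cite: PaulEtAl1983, §2 Lemma 2.2 (k ≥ (log* N)/3)] -/
theorem params {n : ℕ} (hx : 8 ≤ logStar n) :
    ∃ κ, 1 ≤ κ ∧ logStar n < 8 * 2 ^ κ ∧ cseq κ (2 ^ κ) ≤ n := by
  set x := logStar n with hxdef
  have hx0 : x ≠ 0 := by omega
  have hlog3 : 3 ≤ Nat.log 2 x := Nat.le_log_of_pow_le one_lt_two (by simpa using hx)
  refine ⟨Nat.log 2 x - 2, by omega, ?_, ?_⟩
  · have h1 : x < 2 ^ (Nat.log 2 x + 1) := Nat.lt_pow_succ_log_self one_lt_two x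
    have : 2 ^ (Nat.log 2 x + 1) = 8 * 2 ^ (Nat.log 2 x - 2) := by
      rw [show Nat.log 2 x + 1 = 3 + (Nat.log 2 x - 2) by omega, pow_add]; norm_num
    omega
  · set κ := Nat.log 2 x - 2 with hκdef
    have hκ : 1 ≤ κ := by omega
    have h2 : 2 ^ (κ + 2) ≤ x := by
      rw [show κ + 2 = Nat.log 2 x by omega]; exact Nat.pow_log_le_self 2 hx0
    -- `κ + 2^κ + 1 ≤ 2^{κ+2} ≤ x`
    have h3 : κ + 2 ^ κ + 1 ≤ x := by
      have : κ < 2 ^ κ := Nat.lt_two_pow_self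
      have h4 : 2 ^ (κ + 2) = 4 * 2 ^ κ := by rw [pow_add]; ring
      omega
    calc cseq κ (2 ^ κ) ≤ cseq κ (2 ^ κ) + κ + 1 := by omega
      _ ≤ tower (κ + 2 ^ κ + 1) := cseq_bound hκ _
      _ ≤ tower x := tower_mono h3
      _ ≤ n := tower_le_of_le_logStar x n (by omega) le_rfl

/-- **The exponents of the block sizes**: `a₀ = 0` and `a_l = n - c_{k-l}` for `1 ≤ l ≤ k`
(block size `d_l = 2^{a_l}`, so level `l` has `2^{c_{k-l}}` blocks). [cite: PaulEtAl1983, §2 Lemma 2.2 (the numbers d_l)] -/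
def aseq (n κ k l : ℕ) : ℕ := if l = 0 then 0 else n - cseq κ (k - l)

/-- `a₀ = 0` (the discrete partition `P₀`). [folklore] -/
theorem aseq_zero (n κ k : ℕ) : aseq n κ k 0 = 0 := by simp [aseq]

/-- `a_l = n - c_{k-l}` for `l ≠ 0`. [folklore] -/
theorem aseq_of_ne_zero (n κ k : ℕ) {l : ℕ} (hl : l ≠ 0) : aseq n κ k l = n - cseq κ (k - l) := by
  simp [aseq, hl]

/-- The exponents increase: `P_{l+1}` is coarser than `P_l`. [folklore] -/
theorem aseq_le_succ {n κ k : ℕ} (hκ : 1 ≤ κ) (l : ℕ) : aseq n κ k l ≤ aseq n κ k (l + 1) := by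
  rcases Nat.eq_zero_or_pos l with h0 | h0
  · subst h0; simp [aseq]
  · rw [aseq_of_ne_zero _ _ _ (by omega), aseq_of_ne_zero _ _ _ (by omega)]
    have : cseq κ (k - (l + 1)) ≤ cseq κ (k - l) := cseq_mono hκ (by omega)
    omega

/-- `a_k ≤ n`. [folklore] -/
theorem aseq_top_le (n κ k : ℕ) : aseq n κ k k ≤ n := by
  unfold aseq; split_ifs <;> simp

/-- **Lemma 2.2, condition (4)** in logarithmic form: for `l < k`,
`a_l + κ (2^{n - a_{l+1}} + 1) ≤ n + 1`, i.e. `d_l · k^{⌈2^n/d_{l+1}⌉ + 1} ≤ 2 · 2^n`.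
[cite: PaulEtAl1983, §2 Lemma 2.2 (4)] -/
theorem aseq_level {n κ k : ℕ} (hκ : 1 ≤ κ) (hck : cseq κ k ≤ n) {l : ℕ} (hl : l < k) :
    aseq n κ k l + κ * (2 ^ (n - aseq n κ k (l + 1)) + 1) ≤ n + 1 := by
  have hmono := cseq_mono hκ
  have hsub : n - aseq n κ k (l + 1) = cseq κ (k - (l + 1)) := by
    rw [aseq_of_ne_zero _ _ _ (by omega)]
    have : cseq κ (k - (l + 1)) ≤ n := le_trans (hmono (by omega)) hck
    omega
  rw [hsub]
  have hstep : κ * (2 ^ cseq κ (k - (l + 1)) + 1) = cseq κ (k - l) := by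
    rw [show k - l = (k - (l + 1)) + 1 by omega, cseq_succ]
  rw [hstep]
  rcases Nat.eq_zero_or_pos l with h0 | h0
  · subst h0
    rw [aseq_zero]
    have : cseq κ (k - 0) ≤ n := by simpa using hck
    omega
  · rw [aseq_of_ne_zero _ _ _ (by omega)]
    have : cseq κ (k - l) ≤ n := le_trans (hmono (by omega)) hck
    omega


/-! ### Blocks of consecutive vertices -/

/-- The block of vertex `i` when blocks consist of `2^α` consecutive vertices. [cite: PaulEtAl1983, §2 (the partitions P_l)] -/
def blk (α i : ℕ) : ℕ := i / 2 ^ α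

/-- Blocks are monotone in the vertex. [folklore] -/
theorem blk_mono (α : ℕ) {i j : ℕ} (h : i ≤ j) : blk α i ≤ blk α j := Nat.div_le_div_right h

/-- A vertex in an earlier block is earlier. [folklore] -/
theorem lt_of_blk_lt (α : ℕ) {i j : ℕ} (h : blk α i < blk α j) : i < j := by
  by_contra hc
  exact absurd (blk_mono α (not_lt.1 hc)) (not_le.2 h)

/-- Blocks of size one are the vertices. [folklore] -/
@[simp] theorem blk_zero (i : ℕ) : blk 0 i = i := by simp [blk]

/-- Coarser blocks are unions of finer ones. [folklore] -/
theorem blk_blk {α β : ℕ} (h : α ≤ β) (i : ℕ) : blk (β - α) (blk α i) = blk β i := by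
  unfold blk
  rw [Nat.div_div_eq_div_mul, ← pow_add, Nat.add_sub_cancel' h]

/-- Vertices in one fine block lie in one coarse block. [folklore] -/
theorem blk_eq_of_blk_eq {α β : ℕ} (h : α ≤ β) {i j : ℕ} (he : blk α i = blk α j) :
    blk β i = blk β j := by
  rw [← blk_blk h i, ← blk_blk h j, he]

/-- There are `2^{n-α}` blocks of size `2^α` among `2^n` vertices. [folklore] -/
theorem blk_lt_of_lt {α n i : ℕ} (hα : α ≤ n) (hi : i < 2 ^ n) : blk α i < 2 ^ (n - α) := by
  unfold blk
  rw [Nat.div_lt_iff_lt_mul (by positivity), ← pow_add, Nat.sub_add_cancel hα]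
  exact hi

/-- A block has at most `2^α` members (below any bound). [folklore] -/
theorem card_filter_blk_eq_le (α M Y : ℕ) :
    ((Finset.range M).filter fun i => blk α i = Y).card ≤ 2 ^ α := by
  calc ((Finset.range M).filter fun i => blk α i = Y).card
      ≤ (Finset.range (2 ^ α)).card := by
        refine Finset.card_le_card_of_injOn (fun i => i % 2 ^ α) (fun i _ => ?_) ?_
        · exact Finset.mem_coe.2 (Finset.mem_range.2 (Nat.mod_lt _ (by positivity)))
        · intro i hi j hj hij
          simp only [Finset.coe_filter, Set.mem_setOf_eq, blk, Finset.mem_range] at hi hj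
          simp only at hij
          rw [← Nat.div_add_mod i (2 ^ α), ← Nat.div_add_mod j (2 ^ α), hi.2, hj.2, hij]
    _ = 2 ^ α := Finset.card_range _

/-- At most `2^α · |S|` vertices lie in the blocks of `S`. [folklore] -/
theorem card_filter_blk_mem_le (α M : ℕ) (S : Finset ℕ) :
    ((Finset.range M).filter fun i => blk α i ∈ S).card ≤ 2 ^ α * S.card := by
  calc ((Finset.range M).filter fun i => blk α i ∈ S).card
      ≤ (S.biUnion fun Y => (Finset.range M).filter fun i => blk α i = Y).card := by
        refine Finset.card_le_card fun i hi => ?_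
        simp only [Finset.mem_filter, Finset.mem_biUnion] at hi ⊢
        exact ⟨blk α i, hi.2, hi.1, rfl⟩
    _ ≤ ∑ Y ∈ S, ((Finset.range M).filter fun i => blk α i = Y).card := Finset.card_biUnion_le
    _ ≤ ∑ _Y ∈ S, 2 ^ α := Finset.sum_le_sum fun Y _ => card_filter_blk_eq_le α M Y
    _ = 2 ^ α * S.card := by rw [Finset.sum_const, smul_eq_mul, mul_comm]

/-! ### Non-crossing arc sets have at most two arcs per node -/

/-- `X` is the first (least) immediate predecessor of `Y` in the arc set `T`. [cite: PaulEtAl1983, §2 (proof of Thm 2.1, "first immediate predecessor")] -/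
def IsFirstPred (T : Finset (ℕ × ℕ)) (X Y : ℕ) : Prop := (X, Y) ∈ T ∧ ∀ W, (W, Y) ∈ T → X ≤ W

/-- **The claim `Σ D_s(X*) ≤ 2 N*`.** A set of forward arcs on the nodes `< M` no two of which
cross has at most `2M` arcs: a node that is an immediate predecessor of `Y < Z` is the FIRST
immediate predecessor of `Y` (an earlier predecessor `W` of `Y` would give the crossing arcs
`(W, Y)`, `(X, Z)`), so every node is a non-first predecessor of at most one node, and every node
has at most one first predecessor. [cite: PaulEtAl1983, §2 (proof of Thm 2.1, the claim)] -/
theorem card_le_of_nonCrossing (T : Finset (ℕ × ℕ)) (M : ℕ) (hfwd : ∀ e ∈ T, e.1 < e.2)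
    (hM : ∀ e ∈ T, e.2 < M)
    (hnc : ∀ e₁ ∈ T, ∀ e₂ ∈ T, e₁.1 < e₂.1 → e₂.1 < e₁.2 → e₁.2 < e₂.2 → False) :
    T.card ≤ 2 * M := by
  classical
  let g : ℕ × ℕ → ℕ ⊕ ℕ := fun e => if IsFirstPred T e.1 e.2 then Sum.inl e.2 else Sum.inr e.1
  have key : ∀ e₁ ∈ T, ∀ e₂ ∈ T, e₁.1 = e₂.1 → e₁.2 < e₂.2 → IsFirstPred T e₁.1 e₁.2 := by
    intro e₁ h₁ e₂ h₂ heq hlt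
    refine ⟨h₁, fun W hW => ?_⟩
    by_contra hWX
    have hWX : W < e₁.1 := not_le.1 hWX
    exact hnc (W, e₁.2) hW e₂ h₂ (by simpa [heq] using hWX) (by rw [← heq]; exact hfwd e₁ h₁) hlt
  calc T.card ≤ ((Finset.range M).disjSum (Finset.range M)).card := by
        refine Finset.card_le_card_of_injOn g (fun e he => ?_) ?_
        · have he : e ∈ T := by simpa using he
          show g e ∈ _
          simp only [g]
          split_ifs
          · exact Finset.inl_mem_disjSum.2 (Finset.mem_range.2 (hM e he))
          · exact Finset.inr_mem_disjSum.2 (Finset.mem_range.2 (lt_trans (hfwd e he) (hM e he)))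
        · intro e₁ h₁ e₂ h₂ hg
          have h₁ : e₁ ∈ T := by simpa using h₁
          have h₂ : e₂ ∈ T := by simpa using h₂
          simp only [g] at hg
          by_cases hf₁ : IsFirstPred T e₁.1 e₁.2
          · by_cases hf₂ : IsFirstPred T e₂.1 e₂.2
            · rw [if_pos hf₁, if_pos hf₂] at hg
              have h2 : e₁.2 = e₂.2 := Sum.inl_injective hg
              have ha := hf₁.2 e₂.1 (by rw [h2]; exact h₂)
              have hb := hf₂.2 e₁.1 (by rw [← h2]; exact h₁)
              exact Prod.ext (le_antisymm ha hb) h2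
            · rw [if_pos hf₁, if_neg hf₂] at hg
              exact absurd hg Sum.inl_ne_inr
          · by_cases hf₂ : IsFirstPred T e₂.1 e₂.2
            · rw [if_neg hf₁, if_pos hf₂] at hg
              exact absurd hg Sum.inr_ne_inl
            · rw [if_neg hf₁, if_neg hf₂] at hg
              have h1 : e₁.1 = e₂.1 := Sum.inr_injective hg
              rcases lt_trichotomy e₁.2 e₂.2 with hlt | heq | hgt
              · exact absurd (key e₁ h₁ e₂ h₂ h1 hlt) hf₁
              · exact Prod.ext h1 heq
              · exact absurd (key e₂ h₂ e₁ h₁ h1.symm hgt) hf₂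
    _ = 2 * M := by rw [Finset.card_disjSum, Finset.card_range]; ring

/-! ### Geometric sums -/

/-- `G k 0 = 1`, `G k (c+1) = 1 + k · G k c` (`= 1 + k + ⋯ + k^c`). [folklore] -/
def Gf (k : ℕ) : ℕ → ℕ
  | 0 => 1
  | c + 1 => 1 + k * Gf k c

/-- `1 + k + ⋯ + k^c < k^{c+1}` for `k ≥ 2`. [folklore] -/
theorem Gf_succ_le_pow {k : ℕ} (hk : 2 ≤ k) : ∀ c, Gf k c + 1 ≤ k ^ (c + 1)
  | 0 => by simpa [Gf] using hk
  | c + 1 => by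
    have ih := Gf_succ_le_pow hk c
    show 1 + k * Gf k c + 1 ≤ k ^ (c + 1 + 1)
    have : k * (Gf k c + 1) ≤ k * k ^ (c + 1) := Nat.mul_le_mul_left k ih
    rw [pow_succ (k) (c + 1)]
    nlinarith

/-! ### The core construction (proof of Theorem 2.1 on `2^n` vertices) -/

/-- The data of the core construction: a forward edge set `E` on `2^n` vertices covered by `R`
pushdown families, the degree threshold `k = 2^κ`, and block-size exponents `a₀ = 0 ≤ a₁ ≤ ⋯`
with `a_k ≤ n` satisfying Lemma 2.2 (4) in the form `a_l + κ (2^{n - a_{l+1}} + 1) ≤ n + 1`.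
[cite: PaulEtAl1983, §2 (Thm 2.1 and Lemma 2.2)] -/
structure Core where
  /-- `2^n` vertices -/
  n : ℕ
  /-- `k = 2^κ` -/
  κ : ℕ
  /-- exponents of the block sizes `d_l = 2^{a l}` -/
  a : ℕ → ℕ
  /-- number of pushdown families -/
  R : ℕ
  /-- the edges -/
  E : Finset (ℕ × ℕ)
  /-- the covering pushdown families -/
  F : Fin R → Finset (ℕ × ℕ)
  hκ : 1 ≤ κ
  ha0 : a 0 = 0
  hmono : ∀ l, a l ≤ a (l + 1)
  haL : a (2 ^ κ) ≤ n
  hlev : ∀ l < 2 ^ κ, a l + κ * (2 ^ (n - a (l + 1)) + 1) ≤ n + 1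
  hE : ∀ e ∈ E, e.1 < e.2 ∧ e.2 < 2 ^ n
  hF : ∀ s, IsPushdownFamily (F s)
  hFE : ∀ s, F s ⊆ E
  hcov : ∀ e ∈ E, ∃ s, e ∈ F s

namespace Core

open scoped Classical

variable (D : Core)

/-- The degree threshold and number of levels `k = 2^κ`. [folklore] -/
def k : ℕ := 2 ^ D.κ

/-- `k ≥ 2`. [folklore] -/
theorem two_le_k : 2 ≤ D.k := by
  show 2 ^ 1 ≤ 2 ^ D.κ
  exact Nat.pow_le_pow_right two_pos D.hκ

/-- `k > 0`. [folklore] -/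
theorem k_pos : 0 < D.k := lt_of_lt_of_le two_pos D.two_le_k

/-- The block-size exponents are monotone. [folklore] -/
theorem a_monotone : Monotone D.a := monotone_nat_of_le_succ D.hmono

/-- `a_l ≤ n` for `l ≤ k`. [folklore] -/
theorem a_le_n {l : ℕ} (hl : l ≤ D.k) : D.a l ≤ D.n := le_trans (D.a_monotone hl) D.haL

/-! #### The level of an edge and the pigeonhole -/

/-- The level of an edge: the coarsest of the partitions `P_0, …, P_{k-1}` separating its ends.
[cite: PaulEtAl1983, §2 (proof of Thm 2.1, "associate with each edge … the coarsest of the partitions")] -/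
noncomputable def lev (e : ℕ × ℕ) : ℕ :=
  ((Finset.range D.k).filter fun l => blk (D.a l) e.1 ≠ blk (D.a l) e.2).sup id

/-- The level of an edge is `< k`. [folklore] -/
theorem lev_lt (e : ℕ × ℕ) : D.lev e < D.k := by
  unfold lev
  rw [Finset.sup_lt_iff (bot_lt_iff_ne_bot.2 (by simpa using D.k_pos.ne'))]
  intro l hl
  exact Finset.mem_range.1 (Finset.mem_filter.1 hl).1

/-- A separating level is at most the level of the edge. [folklore] -/
theorem le_lev {e : ℕ × ℕ} {l : ℕ} (hl : l < D.k) (hsep : blk (D.a l) e.1 ≠ blk (D.a l) e.2) :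
    l ≤ D.lev e := by
  unfold lev
  exact Finset.le_sup (f := id) (Finset.mem_filter.2 ⟨Finset.mem_range.2 hl, hsep⟩)

/-- The level of an edge separates it (level `0` always does). [folklore] -/
theorem sep_lev {e : ℕ × ℕ} (he : e.1 < e.2) : blk (D.a (D.lev e)) e.1 ≠ blk (D.a (D.lev e)) e.2 := by
  have hne : ((Finset.range D.k).filter fun l => blk (D.a l) e.1 ≠ blk (D.a l) e.2).Nonempty :=
    ⟨0, Finset.mem_filter.2 ⟨Finset.mem_range.2 D.k_pos, by rw [D.ha0]; simp; omega⟩⟩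
  obtain ⟨l, hl, hsup⟩ := Finset.exists_mem_eq_sup _ hne id
  unfold lev
  rw [hsup]
  exact (Finset.mem_filter.1 hl).2

/-- **Pigeonhole over the `k` levels**: some level carries at most `|E| / k` edges.
[cite: PaulEtAl1983, §2 (proof of Thm 2.1, "there must be a partition P_l … at most rN/k edges")] -/
theorem exists_level : ∃ l < D.k, ((D.E.filter fun e => D.lev e = l).card) * D.k ≤ D.E.card := by
  have hsum : D.E.card = ∑ l ∈ Finset.range D.k, (D.E.filter fun e => D.lev e = l).card :=
    Finset.card_eq_sum_card_fiberwise (f := D.lev) fun e _ => Finset.mem_range.2 (D.lev_lt e)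
  obtain ⟨l, hl, hmin⟩ := Finset.exists_min_image (Finset.range D.k)
    (fun l => (D.E.filter fun e => D.lev e = l).card) ⟨0, Finset.mem_range.2 D.k_pos⟩
  refine ⟨l, Finset.mem_range.1 hl, ?_⟩
  calc (D.E.filter fun e => D.lev e = l).card * D.k
      = ∑ _l' ∈ Finset.range D.k, (D.E.filter fun e => D.lev e = l).card := by
        rw [Finset.sum_const, Finset.card_range, smul_eq_mul, mul_comm]
    _ ≤ ∑ l' ∈ Finset.range D.k, (D.E.filter fun e => D.lev e = l').card :=
        Finset.sum_le_sum fun l' hl' => hmin l' hl'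
    _ = D.E.card := hsum.symm

/-- A pushdown family on `2^n` vertices has at most `2^n` edges (in-degree one). [folklore] -/
theorem card_F_le (s : Fin D.R) : (D.F s).card ≤ 2 ^ D.n := by
  calc (D.F s).card ≤ (Finset.range (2 ^ D.n)).card := by
        refine Finset.card_le_card_of_injOn Prod.snd (fun e he => ?_) ?_
        · have he : e ∈ D.F s := by simpa using he
          exact Finset.mem_coe.2 (Finset.mem_range.2 (D.hE e (D.hFE s he)).2)
        · intro e₁ h₁ e₂ h₂ heq
          exact (D.hF s).2.1 e₁ (by simpa using h₁) e₂ (by simpa using h₂) heq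
    _ = 2 ^ D.n := Finset.card_range _

/-- `|E| ≤ R · 2^n`. [cite: PaulEtAl1983, §2 (proof of Thm 2.1, "at most rN edges")] -/
theorem card_E_le : D.E.card ≤ D.R * 2 ^ D.n := by
  calc D.E.card ≤ (Finset.univ.biUnion D.F).card := by
        refine Finset.card_le_card fun e he => ?_
        obtain ⟨s, hs⟩ := D.hcov e he
        exact Finset.mem_biUnion.2 ⟨s, Finset.mem_univ _, hs⟩
    _ ≤ ∑ s, (D.F s).card := Finset.card_biUnion_le
    _ ≤ ∑ _s : Fin D.R, 2 ^ D.n := Finset.sum_le_sum fun s _ => D.card_F_le s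
    _ = D.R * 2 ^ D.n := by simp

/-! #### The chosen level, the set `A`, the collapsed graph -/

/-- The level `l` given by the pigeonhole. [folklore] -/
noncomputable def l : ℕ := Classical.choose D.exists_level

/-- `l < k`. [folklore] -/
theorem l_lt : D.l < D.k := (Classical.choose_spec D.exists_level).1

/-- Level `l` carries at most `|E|/k` edges. [folklore] -/
theorem l_pig : ((D.E.filter fun e => D.lev e = D.l).card) * D.k ≤ D.E.card :=
  (Classical.choose_spec D.exists_level).2

/-- Exponent of the fine block size `d_l = 2^α`. [folklore] -/
noncomputable def α : ℕ := D.a D.l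

/-- Exponent of the coarse block size `d_{l+1} = 2^β`. [folklore] -/
noncomputable def β : ℕ := D.a (D.l + 1)

/-- `α ≤ β`. [folklore] -/
theorem α_le_β : D.α ≤ D.β := D.hmono _

/-- `β ≤ n`. [folklore] -/
theorem β_le_n : D.β ≤ D.n := D.a_le_n (Nat.succ_le_of_lt D.l_lt)

/-- `α ≤ n`. [folklore] -/
theorem α_le_n : D.α ≤ D.n := le_trans D.α_le_β D.β_le_n

/-- **The set `A`**: sources of the edges of level `l`. [cite: PaulEtAl1983, §2 (proof of Thm 2.1, the set A)] -/
noncomputable def A : Finset ℕ := (D.E.filter fun e => D.lev e = D.l).image Prod.fst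

/-- `|A| · k ≤ R · 2^n`. [folklore] -/
theorem card_A : D.A.card * D.k ≤ D.R * 2 ^ D.n :=
  le_trans (le_trans (Nat.mul_le_mul_right _ Finset.card_image_le) D.l_pig) D.card_E_le

/-- The number of nodes `N* = 2^{n-α}` of the collapsed graph. [folklore] -/
noncomputable def Nn : ℕ := 2 ^ (D.n - D.α)

/-- An edge gives an arc of the collapsed graph `G*`: its source is outside `A` and its ends lie
in different blocks of `P_l`. [folklore] -/
def Good (e : ℕ × ℕ) : Prop := e.1 ∉ D.A ∧ blk D.α e.1 ≠ blk D.α e.2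

/-- The arc of an edge. [folklore] -/
noncomputable def nd (e : ℕ × ℕ) : ℕ × ℕ := (blk D.α e.1, blk D.α e.2)

/-- **The arcs of `G*_s`** (from the family `s`). [cite: PaulEtAl1983, §2 (proof of Thm 2.1, the graphs G*_s)] -/
noncomputable def Arc (s : Fin D.R) : Finset (ℕ × ℕ) := ((D.F s).filter D.Good).image D.nd

/-- **The arcs of `G*`**. [cite: PaulEtAl1983, §2 (proof of Thm 2.1, the graph G*)] -/
noncomputable def Arcs : Finset (ℕ × ℕ) := (D.E.filter D.Good).image D.nd

/-- Every arc of `G*` is an arc of some `G*_s`. [folklore] -/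
theorem arcs_subset : D.Arcs ⊆ Finset.univ.biUnion D.Arc := by
  intro p hp
  simp only [Arcs, Finset.mem_image, Finset.mem_filter] at hp
  obtain ⟨e, ⟨he, hg⟩, rfl⟩ := hp
  obtain ⟨s, hs⟩ := D.hcov e he
  exact Finset.mem_biUnion.2 ⟨s, Finset.mem_univ _,
    Finset.mem_image.2 ⟨e, Finset.mem_filter.2 ⟨hs, hg⟩, rfl⟩⟩

/-- **Arcs go forward, stay below `N*`, and join different blocks of `P_{l+1}`**: an edge of
`G − A` separated by `P_l` is not of level `l`, hence of a higher level, hence separated by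
`P_{l+1}`. [cite: PaulEtAl1983, §2 (proof of Thm 2.1, "every edge (i, j) of G − A either …")] -/
theorem nd_props {e : ℕ × ℕ} (he : e ∈ D.E) (hg : D.Good e) :
    blk D.α e.1 < blk D.α e.2 ∧ blk D.α e.2 < D.Nn ∧ blk D.β e.1 < blk D.β e.2 := by
  have hfwd := (D.hE e he).1
  refine ⟨lt_of_le_of_ne (blk_mono _ hfwd.le) hg.2, blk_lt_of_lt D.α_le_n (D.hE e he).2, ?_⟩
  -- the level of `e` is not `l` (else `e.1 ∈ A`) and at least `l`
  have hne : D.lev e ≠ D.l := by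
    intro hcon
    exact hg.1 (Finset.mem_image.2 ⟨e, Finset.mem_filter.2 ⟨he, hcon⟩, rfl⟩)
  have hge : D.l ≤ D.lev e := D.le_lev D.l_lt hg.2
  have hgt : D.l + 1 ≤ D.lev e := by omega
  have hsep := D.sep_lev hfwd
  have hβ : blk D.β e.1 ≠ blk D.β e.2 := fun hcon =>
    hsep (blk_eq_of_blk_eq (D.a_monotone hgt) hcon)
  exact lt_of_le_of_ne (blk_mono _ hfwd.le) hβ

/-- Unfolding membership in `Arc s`. [folklore] -/
theorem mem_Arc {s : Fin D.R} {p : ℕ × ℕ} (hp : p ∈ D.Arc s) :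
    ∃ e ∈ D.F s, D.Good e ∧ D.nd e = p := by
  simp only [Arc, Finset.mem_image, Finset.mem_filter] at hp
  obtain ⟨e, ⟨he, hg⟩, rfl⟩ := hp
  exact ⟨e, he, hg, rfl⟩

/-- Unfolding membership in `Arcs`. [folklore] -/
theorem mem_Arcs {p : ℕ × ℕ} (hp : p ∈ D.Arcs) : ∃ e ∈ D.E, D.Good e ∧ D.nd e = p := by
  simp only [Arcs, Finset.mem_image, Finset.mem_filter] at hp
  obtain ⟨e, ⟨he, hg⟩, rfl⟩ := hp
  exact ⟨e, he, hg, rfl⟩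

/-- **Arcs of one family do not cross** (the underlying edges would). [cite: PaulEtAl1983, §2 (proof of Thm 2.1, "the edges of G_s that give rise to these arcs would also cross")] -/
theorem nonCrossing_Arc (s : Fin D.R) :
    ∀ p₁ ∈ D.Arc s, ∀ p₂ ∈ D.Arc s, p₁.1 < p₂.1 → p₂.1 < p₁.2 → p₁.2 < p₂.2 → False := by
  intro p₁ h₁ p₂ h₂ ha hb hc
  obtain ⟨e₁, he₁, -, rfl⟩ := D.mem_Arc h₁
  obtain ⟨e₂, he₂, -, rfl⟩ := D.mem_Arc h₂
  simp only [nd] at ha hb hc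
  have h := (D.hF s).2.2 e₁ he₁ e₂ he₂ (lt_of_blk_lt _ ha) (lt_of_blk_lt _ hb)
  have := lt_of_blk_lt _ hc
  omega

/-- `|Arc s| ≤ 2 N*`. [cite: PaulEtAl1983, §2 (proof of Thm 2.1, Σ D_s(X*) ≤ 2N*)] -/
theorem card_Arc_le (s : Fin D.R) : (D.Arc s).card ≤ 2 * D.Nn := by
  refine card_le_of_nonCrossing _ _ (fun p hp => ?_) (fun p hp => ?_) (D.nonCrossing_Arc s)
  · obtain ⟨e, he, hg, rfl⟩ := D.mem_Arc hp
    exact (D.nd_props (D.hFE s he) hg).1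
  · obtain ⟨e, he, hg, rfl⟩ := D.mem_Arc hp
    exact (D.nd_props (D.hFE s he) hg).2.1

/-- `|Arcs| ≤ 2 R N*` (`Σ D(X*) ≤ 2rN*`). [cite: PaulEtAl1983, §2 (proof of Thm 2.1)] -/
theorem card_Arcs_le : D.Arcs.card ≤ D.R * (2 * D.Nn) := by
  calc D.Arcs.card ≤ (Finset.univ.biUnion D.Arc).card := Finset.card_le_card D.arcs_subset
    _ ≤ ∑ s, (D.Arc s).card := Finset.card_biUnion_le
    _ ≤ ∑ _s : Fin D.R, 2 * D.Nn := Finset.sum_le_sum fun s _ => D.card_Arc_le s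
    _ = D.R * (2 * D.Nn) := by simp

/-! #### In-degrees, bad nodes, the set `B`, and `J` -/

/-- The in-degree `D(Y*)` of a node of `G*`. [folklore] -/
noncomputable def indeg (Y : ℕ) : ℕ := (D.Arcs.filter fun e => e.2 = Y).card

/-- `Σ_Y D(Y*) = |Arcs|`. [folklore] -/
theorem sum_indeg : ∑ Y ∈ Finset.range D.Nn, D.indeg Y = D.Arcs.card := by
  unfold indeg
  refine (Finset.card_eq_sum_card_fiberwise (f := Prod.snd) fun p hp => ?_).symm
  obtain ⟨e, he, hg, rfl⟩ := D.mem_Arcs hp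
  exact Finset.mem_range.2 (D.nd_props he hg).2.1

/-- **The bad nodes `B*`**: in-degree `> k`. [cite: PaulEtAl1983, §2 (proof of Thm 2.1, "a node X* in G* is bad if D(X*) > k")] -/
noncomputable def Bstar : Finset ℕ := (Finset.range D.Nn).filter fun Y => D.k < D.indeg Y

/-- `|B*| (k+1) ≤ 2 R N*`. [cite: PaulEtAl1983, §2 (proof of Thm 2.1, |B*| ≤ 2rN*/k)] -/
theorem card_Bstar : D.Bstar.card * (D.k + 1) ≤ D.R * (2 * D.Nn) := by
  calc D.Bstar.card * (D.k + 1) ≤ ∑ Y ∈ D.Bstar, D.indeg Y := by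
        have := Finset.card_nsmul_le_sum D.Bstar D.indeg (D.k + 1)
          (fun Y hY => Nat.succ_le_of_lt (Finset.mem_filter.1 hY).2)
        simpa using this
    _ ≤ ∑ Y ∈ Finset.range D.Nn, D.indeg Y :=
        Finset.sum_le_sum_of_subset (Finset.filter_subset _ _)
    _ = D.Arcs.card := D.sum_indeg
    _ ≤ D.R * (2 * D.Nn) := D.card_Arcs_le

/-- **The set `B`**: vertices in the blocks of bad nodes. [cite: PaulEtAl1983, §2 (proof of Thm 2.1, the set B)] -/
noncomputable def B : Finset ℕ := (Finset.range (2 ^ D.n)).filter fun i => blk D.α i ∈ D.Bstar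

/-- `d_l · N* = 2^n`. [folklore] -/
theorem two_pow_α_mul_Nn : 2 ^ D.α * D.Nn = 2 ^ D.n := by
  rw [Nn, ← pow_add, Nat.add_sub_cancel' D.α_le_n]

/-- `|B| (k+1) ≤ 2 R · 2^n`. [cite: PaulEtAl1983, §2 (proof of Thm 2.1, |B| ≤ 4rN/k)] -/
theorem card_B : D.B.card * (D.k + 1) ≤ 2 * D.R * 2 ^ D.n := by
  calc D.B.card * (D.k + 1) ≤ 2 ^ D.α * D.Bstar.card * (D.k + 1) :=
        Nat.mul_le_mul_right _ (card_filter_blk_mem_le _ _ _)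
    _ = 2 ^ D.α * (D.Bstar.card * (D.k + 1)) := by ring
    _ ≤ 2 ^ D.α * (D.R * (2 * D.Nn)) := Nat.mul_le_mul_left _ D.card_Bstar
    _ = 2 * D.R * (2 ^ D.α * D.Nn) := by ring
    _ = 2 * D.R * 2 ^ D.n := by rw [D.two_pow_α_mul_Nn]

/-- **The segregator `J = A ∪ B`**. [cite: PaulEtAl1983, §2 (proof of Thm 2.1, "Let J be the union of A and B")] -/
noncomputable def J : Finset ℕ := D.A ∪ D.B

/-- `|J| · k ≤ 3 R · 2^n` (`|J| ≤ 5rN/k` as printed). [cite: PaulEtAl1983, §2 (Thm 2.1, |J| ≤ 15rN/log* N)] -/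
theorem card_J : D.J.card * D.k ≤ 3 * D.R * 2 ^ D.n := by
  have hA := D.card_A
  have hB := D.card_B
  have hB' : D.B.card * D.k ≤ 2 * D.R * 2 ^ D.n :=
    le_trans (Nat.mul_le_mul_left _ (Nat.le_succ _)) hB
  calc D.J.card * D.k ≤ (D.A.card + D.B.card) * D.k :=
        Nat.mul_le_mul_right _ (Finset.card_union_le _ _)
    _ = D.A.card * D.k + D.B.card * D.k := by ring
    _ ≤ D.R * 2 ^ D.n + 2 * D.R * 2 ^ D.n := Nat.add_le_add hA hB'
    _ = 3 * D.R * 2 ^ D.n := by ring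

/-! #### Predecessors in `G* − B*` -/

/-- The immediate predecessors of a node `Y ∉ B*` inside `G* − B*`. [folklore] -/
noncomputable def preds (Y : ℕ) : Finset ℕ :=
  if Y ∈ D.Bstar then ∅ else (D.Arcs.filter fun e => e.2 = Y ∧ e.1 ∉ D.Bstar).image Prod.fst

/-- Unfolding membership in `preds`. [folklore] -/
theorem mem_preds {X Y : ℕ} (h : X ∈ D.preds Y) : (X, Y) ∈ D.Arcs ∧ X ∉ D.Bstar ∧ Y ∉ D.Bstar := by
  unfold preds at h
  split_ifs at h with hY
  · simp at h
  · simp only [Finset.mem_image, Finset.mem_filter] at h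
    obtain ⟨e, ⟨he, h2, h1⟩, rfl⟩ := h
    refine ⟨?_, h1, hY⟩
    have : e = (e.1, Y) := by rw [← h2]
    rw [← this]; exact he

/-- An arc between nodes outside `B*` is a `preds` step. [folklore] -/
theorem mem_preds_of {X Y : ℕ} (hXY : (X, Y) ∈ D.Arcs) (hX : X ∉ D.Bstar) (hY : Y ∉ D.Bstar) :
    X ∈ D.preds Y := by
  unfold preds
  rw [if_neg hY]
  exact Finset.mem_image.2 ⟨(X, Y), Finset.mem_filter.2 ⟨hXY, rfl, hX⟩, rfl⟩

/-- A node outside `B*` has at most `k` immediate predecessors. [cite: PaulEtAl1983, §2 (proof of Thm 2.1)] -/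
theorem card_preds_le (Y : ℕ) : (D.preds Y).card ≤ D.k := by
  unfold preds
  split_ifs with hY
  · simp
  · calc ((D.Arcs.filter fun e => e.2 = Y ∧ e.1 ∉ D.Bstar).image Prod.fst).card
        ≤ (D.Arcs.filter fun e => e.2 = Y ∧ e.1 ∉ D.Bstar).card := Finset.card_image_le
      _ ≤ D.indeg Y := by
          unfold indeg
          exact Finset.card_le_card (Finset.monotone_filter_right _ fun e _ h => h.1)
      _ ≤ D.k := by
          by_contra hcon
          have hlt : D.k < D.indeg Y := not_le.1 hcon
          rcases Nat.lt_or_ge Y D.Nn with hYN | hYN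
          · exact hY (Finset.mem_filter.2 ⟨Finset.mem_range.2 hYN, hlt⟩)
          · -- no arc ends at `Y ≥ N*`
            have : D.indeg Y = 0 := by
              unfold indeg
              rw [Finset.card_eq_zero, Finset.filter_eq_empty_iff]
              intro p hp hpY
              obtain ⟨e, he, hg, rfl⟩ := D.mem_Arcs hp
              have := (D.nd_props he hg).2.1
              simp only [nd] at hpY this
              omega
            omega

/-- The coarse blocks have `Q = 2^{β-α}` fine blocks each. [folklore] -/
noncomputable def Q : ℕ := 2 ^ (D.β - D.α)

/-- Arcs of `G* − B*` advance the coarse block. [cite: PaulEtAl1983, §2 (proof of Thm 2.1, "the longest directed path in G* has length at most M* − 1")] -/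
theorem coarse_lt_of_mem_preds {X Y : ℕ} (h : X ∈ D.preds Y) : X / D.Q < Y / D.Q := by
  obtain ⟨hXY, -, -⟩ := D.mem_preds h
  obtain ⟨e, he, hg, hnd⟩ := D.mem_Arcs hXY
  simp only [nd, Prod.mk.injEq] at hnd
  obtain ⟨rfl, rfl⟩ := hnd
  have h3 := (D.nd_props he hg).2.2
  have e1 : blk D.α e.1 / D.Q = blk D.β e.1 := blk_blk D.α_le_β e.1
  have e2 : blk D.α e.2 / D.Q = blk D.β e.2 := blk_blk D.α_le_β e.2
  rw [e1, e2]; exact h3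

/-- Fuelled reflexive ancestor sets in `G* − B*`: `Pc 0 Y = {Y}`,
`Pc (c+1) Y = {Y} ∪ ⋃_{X ∈ preds Y} Pc c X`. [folklore] -/
noncomputable def Pc : ℕ → ℕ → Finset ℕ
  | 0, Y => {Y}
  | c + 1, Y => insert Y ((D.preds Y).biUnion (Pc c))

/-- **`|Pc c Y| ≤ 1 + k + ⋯ + k^c`** (in-degree `≤ k` off `B*`). [cite: PaulEtAl1983, §2 (proof of Thm 2.1, "at most exp_k M* predecessors in G* − B*")] -/
theorem card_Pc_le : ∀ c Y, (D.Pc c Y).card ≤ Gf D.k c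
  | 0, Y => by simp [Pc, Gf]
  | c + 1, Y => by
    show (insert Y ((D.preds Y).biUnion (D.Pc c))).card ≤ 1 + D.k * Gf D.k c
    calc (insert Y ((D.preds Y).biUnion (D.Pc c))).card
        ≤ ((D.preds Y).biUnion (D.Pc c)).card + 1 := Finset.card_insert_le _ _
      _ ≤ (∑ X ∈ D.preds Y, (D.Pc c X).card) + 1 :=
          Nat.add_le_add_right Finset.card_biUnion_le _
      _ ≤ (∑ _X ∈ D.preds Y, Gf D.k c) + 1 :=
          Nat.add_le_add_right (Finset.sum_le_sum fun X _ => card_Pc_le c X) _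
      _ = (D.preds Y).card * Gf D.k c + 1 := by rw [Finset.sum_const, smul_eq_mul]
      _ ≤ D.k * Gf D.k c + 1 := Nat.add_le_add_right (Nat.mul_le_mul_right _ (D.card_preds_le Y)) _
      _ = 1 + D.k * Gf D.k c := by ring

/-- The immediate-predecessor relation of `G* − B*`. [folklore] -/
def PA (X Y : ℕ) : Prop := X ∈ D.preds Y

/-- Every reflexive ancestor of `Y` in `G* − B*` lies in `Pc c Y` once `c ≥` the coarse block of
`Y` (paths advance the coarse block). [cite: PaulEtAl1983, §2 (proof of Thm 2.1)] -/
theorem mem_Pc_of_reflTransGen : ∀ (c X Y : ℕ), Y / D.Q ≤ c → ReflTransGen D.PA X Y → X ∈ D.Pc c Y := by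
  intro c
  induction c with
  | zero =>
    intro X Y hc h
    rcases h.cases_tail with rfl | ⟨Z, _, hZY⟩
    · simp [Pc]
    · have := D.coarse_lt_of_mem_preds hZY
      exact absurd hc (not_le.2 (lt_of_le_of_lt (Nat.zero_le _) this))
  | succ c ih =>
    intro X Y hc h
    show X ∈ insert Y ((D.preds Y).biUnion (D.Pc c))
    rcases h.cases_tail with rfl | ⟨Z, hXZ, hZY⟩
    · exact Finset.mem_insert_self _ _
    · have hlt := D.coarse_lt_of_mem_preds hZY
      refine Finset.mem_insert_of_mem (Finset.mem_biUnion.2 ⟨Z, hZY, ih X Z (by omega) hXZ⟩)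

/-! #### From paths of `G − J` to paths of `G* − B*` -/

/-- The edge relation of `G − J`. [folklore] -/
def Rel (u v : ℕ) : Prop := (u, v) ∈ D.E ∧ u ∉ D.J ∧ v ∉ D.J

/-- One edge of `G − J` either stays inside a block of `P_l` or gives an arc of `G* − B*`.
[cite: PaulEtAl1983, §2 (proof of Thm 2.1, "then X* must be a predecessor of Y* in G* − B*")] -/
theorem step_blocks {u v : ℕ} (h : D.Rel u v) :
    blk D.α u = blk D.α v ∨ D.PA (blk D.α u) (blk D.α v) := by
  obtain ⟨huv, huJ, hvJ⟩ := h
  by_cases hsep : blk D.α u = blk D.α v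
  · exact Or.inl hsep
  · right
    have hv : v < 2 ^ D.n := (D.hE _ huv).2
    have hu : u < 2 ^ D.n := lt_trans (D.hE _ huv).1 hv
    have huA : u ∉ D.A := fun hc => huJ (Finset.mem_union_left _ hc)
    have hgood : D.Good (u, v) := ⟨huA, hsep⟩
    have harc : (blk D.α u, blk D.α v) ∈ D.Arcs :=
      Finset.mem_image.2 ⟨(u, v), Finset.mem_filter.2 ⟨huv, hgood⟩, rfl⟩
    have huB : blk D.α u ∉ D.Bstar := fun hc =>
      huJ (Finset.mem_union_right _ (Finset.mem_filter.2 ⟨Finset.mem_range.2 hu, hc⟩))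
    have hvB : blk D.α v ∉ D.Bstar := fun hc =>
      hvJ (Finset.mem_union_right _ (Finset.mem_filter.2 ⟨Finset.mem_range.2 hv, hc⟩))
    exact D.mem_preds_of harc huB hvB

/-- A path of `G − J` projects to a (possibly shorter) path of `G* − B*`. [cite: PaulEtAl1983, §2 (proof of Thm 2.1, last paragraph)] -/
theorem reflTransGen_of_transGen {u v : ℕ} (h : TransGen D.Rel u v) :
    ReflTransGen D.PA (blk D.α u) (blk D.α v) := by
  induction h with
  | single hr =>
    rcases D.step_blocks hr with he | hp
    · rw [he]
    · exact ReflTransGen.single hp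
  | tail _ hr ih =>
    rcases D.step_blocks hr with he | hp
    · rw [← he]; exact ih
    · exact ih.tail hp

/-- Ancestors are vertices `< 2^n`. [folklore] -/
theorem lt_of_transGen {u v : ℕ} (h : TransGen D.Rel u v) : u < 2 ^ D.n := by
  induction h with
  | single hr => exact lt_trans (D.hE _ hr.1).1 (D.hE _ hr.1).2
  | tail _ _ ih => exact ih

/-- The ancestors of `v` in `G − J` lie in the blocks of the reflexive ancestors of its node in
`G* − B*`. [cite: PaulEtAl1983, §2 (proof of Thm 2.1, last paragraph)] -/
theorem ancestors_subset (v : ℕ) :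
    ancestorsAvoiding D.E D.J v ⊆
      ↑((Finset.range (2 ^ D.n)).filter fun u => blk D.α u ∈ D.Pc (blk D.β v) (blk D.α v)) := by
  intro u hu
  have hu : TransGen D.Rel u v := hu
  simp only [Finset.coe_filter, Finset.mem_range, Set.mem_setOf_eq]
  refine ⟨D.lt_of_transGen hu, D.mem_Pc_of_reflTransGen _ _ _ ?_ (D.reflTransGen_of_transGen hu)⟩
  rw [show blk D.α v / D.Q = blk D.β v from blk_blk D.α_le_β v]

/-- **Every vertex of `G − J` has at most `2^{n+1-κ} = 2 · 2^n / k` ancestors in `G − J`.**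
[cite: PaulEtAl1983, §2 (Thm 2.1, "at most d_l N*/k ≤ 2N/k ≤ 6N/log* N predecessors in G − J")] -/
theorem ncard_ancestors_le {v : ℕ} (hv : v < 2 ^ D.n) :
    (ancestorsAvoiding D.E D.J v).ncard ≤ 2 ^ (D.n + 1 - D.κ) := by
  set c := blk D.β v with hc
  have hcM : c + 1 ≤ 2 ^ (D.n - D.β) := blk_lt_of_lt D.β_le_n hv
  have hk2 := D.two_le_k
  have hlev := D.hlev D.l D.l_lt
  -- `α + κ 2^{n-β} + κ ≤ n + 1`
  have hexp : D.α + D.κ * 2 ^ (D.n - D.β) ≤ D.n + 1 - D.κ := by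
    have : D.a D.l + D.κ * (2 ^ (D.n - D.a (D.l + 1)) + 1) ≤ D.n + 1 := hlev
    change D.α + D.κ * (2 ^ (D.n - D.β) + 1) ≤ D.n + 1 at this
    rw [mul_add, mul_one] at this
    omega
  calc (ancestorsAvoiding D.E D.J v).ncard
      ≤ (↑((Finset.range (2 ^ D.n)).filter fun u => blk D.α u ∈ D.Pc c (blk D.α v)) : Set ℕ).ncard :=
        Set.ncard_le_ncard (D.ancestors_subset v) (Finset.finite_toSet _)
    _ = ((Finset.range (2 ^ D.n)).filter fun u => blk D.α u ∈ D.Pc c (blk D.α v)).card :=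
        Set.ncard_coe_finset _
    _ ≤ 2 ^ D.α * (D.Pc c (blk D.α v)).card := card_filter_blk_mem_le _ _ _
    _ ≤ 2 ^ D.α * Gf D.k c := Nat.mul_le_mul_left _ (D.card_Pc_le _ _)
    _ ≤ 2 ^ D.α * D.k ^ (c + 1) := Nat.mul_le_mul_left _ (by have := Gf_succ_le_pow hk2 c; omega)
    _ ≤ 2 ^ D.α * D.k ^ (2 ^ (D.n - D.β)) :=
        Nat.mul_le_mul_left _ (Nat.pow_le_pow_right D.k_pos hcM)
    _ = 2 ^ (D.α + D.κ * 2 ^ (D.n - D.β)) := by rw [k, ← pow_mul, ← pow_add]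
    _ ≤ 2 ^ (D.n + 1 - D.κ) := Nat.pow_le_pow_right two_pos hexp

/-- **Theorem 2.1 on `2^n` vertices**: `J` is a `(2 · 2^n / k)`-segregator with `|J| k ≤ 3R · 2^n`.
[cite: PaulEtAl1983, §2 Thm 2.1] -/
theorem isSegregator_J : IsSegregator (2 ^ (D.n + 1 - D.κ)) D.J D.E (2 ^ D.n) :=
  fun _ hv _ => D.ncard_ancestors_le hv

end Core

/-- **The core of Theorem 2.1** (on `2^n` vertices, with the parameters of Lemma 2.2 supplied).
[cite: PaulEtAl1983, §2 Thm 2.1] -/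
theorem core_segregator (D : Core) :
    ∃ J : Finset ℕ, J.card * 2 ^ D.κ ≤ 3 * D.R * 2 ^ D.n ∧
      IsSegregator (2 ^ (D.n + 1 - D.κ)) J D.E (2 ^ D.n) :=
  ⟨D.J, D.card_J, D.isSegregator_J⟩


/-! ### Theorem 2.1 for arbitrary `N` over the tree's `H_r(N)` -/

/-- The successor edges of any edge set form a pushdown family. [folklore] -/
theorem isPushdownFamily_filter_succ (E : Finset (ℕ × ℕ)) :
    IsPushdownFamily (E.filter fun e => e.2 = e.1 + 1) := by
  refine ⟨fun e he => ?_, fun e₁ h₁ e₂ h₂ heq => ?_, fun e₁ h₁ e₂ h₂ ha hb => ?_⟩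
  · have := (Finset.mem_filter.1 he).2; omega
  · have h1 := (Finset.mem_filter.1 h₁).2; have h2 := (Finset.mem_filter.1 h₂).2
    exact Prod.ext (by omega) heq
  · have h1 := (Finset.mem_filter.1 h₁).2; have h2 := (Finset.mem_filter.1 h₂).2
    omega

/-- Monotonicity of segregators in the bound and in the vertex range. [folklore] -/
theorem isSegregator_mono {M M' N N' : ℕ} {J : Finset ℕ} {E : Finset (ℕ × ℕ)}
    (h : IsSegregator M J E N') (hM : M ≤ M') (hN : N ≤ N') : IsSegregator M' J E N :=
  fun v hv hvJ => le_trans (h v (lt_of_lt_of_le hv hN) hvJ) hM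

end PPSTSeg

open PPSTSeg in
/-- **The segregator theorem (Paul–Pippenger–Szemerédi–Trotter 1983, Theorem 2.1).** PRINTED:
"Let `G` be a graph in `H_r(N)` with `N ≥ 16`. There is a set `J` of at most `15rN/log* N`
vertices of `G` such that every vertex of `G − J` has at most `6N/log* N` predecessors in
`G − J`." VENDORED over the tree's `IsMultiPushdownGraph r N E` (edges on `{0,…,N-1}` covered by
the successor edges and `r` pushdown families — the printed `H_{r+1}(N)`, whose `H₁` also bounds
out-degrees, a condition the proof never uses) and `IsSegregator` (predecessors = ancestors along
paths avoiding `J`), with the two printed bounds merged into one constant `C = C(r)` valid for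
ALL `N` (small `N`, where `log* N` is bounded, take `J = {0,…,N-1}`): `|J| · log* N ≤ C N` and
every vertex outside `J` has at most `C N / log* N` ancestors in `G − J`. The proof is the printed
one: Lemma 2.2's block sizes (`PPSTSeg.params`, `PPSTSeg.aseq_level`), the level of an edge and
the pigeonhole giving `A`, the collapsed graphs `G*_s` whose arcs do not cross so that
`Σ D(X*) ≤ 2rN*` (`PPSTSeg.card_le_of_nonCrossing`), the bad nodes `B*` and `B`, `J = A ∪ B`, and
the count of predecessors in `G* − B*` through in-degree `≤ k` and coarse-block-increasing paths
(`PPSTSeg.Core.ncard_ancestors_le`). [cite: PaulEtAl1983, §2 Theorem 2.1 (p. 431) with Lemma 2.2 and its proof (pp. 431–432)] -/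
theorem segregator_theorem (r : ℕ) : ∃ C : ℕ, ∀ (N : ℕ) (E : Finset (ℕ × ℕ)),
    IsMultiPushdownGraph r N E →
      ∃ J : Finset ℕ, J.card * logStar N ≤ C * N ∧ IsSegregator (C * N / logStar N) J E N := by
  refine ⟨48 * (r + 1) + 32, fun N E hG => ?_⟩
  obtain ⟨hE, F, hF, hcov⟩ := hG
  rcases Nat.eq_zero_or_pos N with hN0 | hNpos
  · refine ⟨∅, by simp, fun v hv => ?_⟩
    omega
  set n := Nat.size N with hndef
  have hNlt : N < 2 ^ n := Nat.lt_size_self N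
  have hnpos : 0 < n := Nat.size_pos.2 hNpos
  have hNge : 2 ^ (n - 1) ≤ N := Nat.lt_size.1 (by omega)
  have hlogN : logStar N ≤ logStar n + 1 :=
    calc logStar N ≤ logStar (2 ^ n) := logStar_monotone hNlt.le
      _ = logStar n + 1 := logStar_two_pow hnpos
  by_cases hsmall : logStar n < 8
  · -- small `N`: everything is the segregator
    refine ⟨Finset.range N, ?_, isSegregator_range _ _ _⟩
    rw [Finset.card_range]
    calc N * logStar N ≤ N * 9 := Nat.mul_le_mul_left _ (by omega)
      _ = 9 * N := mul_comm _ _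
      _ ≤ (48 * (r + 1) + 32) * N := Nat.mul_le_mul_right _ (by omega)
  · rw [not_lt] at hsmall
    obtain ⟨κ, hκ, hxk, hck⟩ := params hsmall
    -- the covering families: successor edges, and `E ∩ F m`
    let F' : Fin (r + 1) → Finset (ℕ × ℕ) :=
      Fin.cases (E.filter fun e => e.2 = e.1 + 1) (fun m => E.filter fun e => e ∈ F m)
    have hF'0 : F' 0 = E.filter fun e => e.2 = e.1 + 1 := rfl
    have hF's : ∀ m : Fin r, F' m.succ = E.filter fun e => e ∈ F m := fun m => rfl
    let D : Core :=
      { n := n, κ := κ, a := aseq n κ (2 ^ κ), R := r + 1, E := E, F := F',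
        hκ := hκ, ha0 := aseq_zero _ _ _, hmono := aseq_le_succ hκ, haL := aseq_top_le _ _ _,
        hlev := fun l hl => aseq_level hκ hck hl,
        hE := fun e he => ⟨(hE e he).1, lt_trans (hE e he).2 hNlt⟩,
        hF := fun s => by
          refine Fin.cases ?_ (fun m => ?_) s
          · rw [hF'0]; exact isPushdownFamily_filter_succ E
          · rw [hF's]; exact (hF m).subset fun e he => (Finset.mem_filter.1 he).2,
        hFE := fun s => by
          refine Fin.cases ?_ (fun m => ?_) s
          · rw [hF'0]; exact Finset.filter_subset _ _
          · rw [hF's]; exact Finset.filter_subset _ _,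
        hcov := fun e he => by
          rcases hcov e he with h1 | ⟨m, hm⟩
          · exact ⟨0, by rw [hF'0]; exact Finset.mem_filter.2 ⟨he, h1⟩⟩
          · exact ⟨m.succ, by rw [hF's]; exact Finset.mem_filter.2 ⟨he, hm⟩⟩ }
    obtain ⟨J, hJk, hJseg⟩ := core_segregator D
    change J.card * 2 ^ κ ≤ 3 * (r + 1) * 2 ^ n at hJk
    change IsSegregator (2 ^ (n + 1 - κ)) J E (2 ^ n) at hJseg
    -- arithmetic
    set k := 2 ^ κ with hkdef
    have hkpos : 0 < k := by positivity
    have hlogk : logStar N ≤ 8 * k := by omega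
    have h2n : 2 ^ n ≤ 2 * N := by
      have : 2 ^ n = 2 * 2 ^ (n - 1) := by
        rw [← pow_succ']; congr 1; omega
      omega
    have hκn : κ ≤ n := by
      have h1 : cseq κ 1 ≤ cseq κ (2 ^ κ) := cseq_mono hκ Nat.one_le_two_pow
      have h2 : cseq κ 1 = κ * 2 := by simp [cseq_succ]
      omega
    have hN2 : 2 ≤ N := by
      have : 2 ≤ n := by
        by_contra hcon
        have : n = 1 := by omega
        rw [this] at hsmall
        simp at hsmall
      calc 2 = 2 ^ 1 := rfl
        _ ≤ 2 ^ (n - 1) := Nat.pow_le_pow_right two_pos (by omega)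
        _ ≤ N := hNge
    have hlogpos : 0 < logStar N := by
      rw [logStar_of_two_le hN2]; exact Nat.succ_pos _
    refine ⟨J, ?_, isSegregator_mono hJseg ?_ hNlt.le⟩
    · calc J.card * logStar N ≤ J.card * (8 * k) := Nat.mul_le_mul_left _ hlogk
        _ = 8 * (J.card * k) := by ring
        _ ≤ 8 * (3 * (r + 1) * 2 ^ n) := Nat.mul_le_mul_left _ hJk
        _ ≤ 8 * (3 * (r + 1) * (2 * N)) :=
            Nat.mul_le_mul_left _ (Nat.mul_le_mul_left _ h2n)
        _ = 48 * (r + 1) * N := by ring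
        _ ≤ (48 * (r + 1) + 32) * N := Nat.mul_le_mul_right _ (by omega)
    · calc 2 ^ (n + 1 - κ) ≤ 4 * N / k := by
            rw [Nat.le_div_iff_mul_le hkpos, hkdef, ← pow_add,
              show n + 1 - κ + κ = n + 1 by omega, pow_succ]
            omega
        _ = 8 * (4 * N) / (8 * k) := (Nat.mul_div_mul_left _ _ (by norm_num)).symm
        _ = 32 * N / (8 * k) := by ring_nf
        _ ≤ (48 * (r + 1) + 32) * N / (8 * k) :=
            Nat.div_le_div_right (Nat.mul_le_mul_right _ (by omega))
        _ ≤ (48 * (r + 1) + 32) * N / logStar N :=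
            Nat.div_le_div_left hlogk hlogpos

end Literature.Computability.Complexity
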